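import Summits.ValiantsHypothesis.ValiantsHypothesis.Theorems.LacunarySymmetroidMatrixDescartesCensusDoorA34SheetTwoGrafts

/-!
# `MatrixDescartes` census — DOOR A at `(3,4)`: the HYPERBOLIC GRAFT CALCULUS of the indefinite cell — `det(M + h·(vwᵀ + wvᵀ))`,
# the adjugate GRAM identity `q_v·q_w − m_{vw}·m_{wv} = det M · (v×w)ᵀ M (v×w)`, the sheet identity `T·det F = q_v q_w − (m − h·y·T)²`,
# and the coordinate-free sign laws it carries (type law, isotropy law, ODD-CROSSING LAW)

HONEST FRAMING.  Object-search cell `pub-symmetroid`, engine seat `val-sym-eng-2` (g7); helper row beside the registered strata line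
`Cruxes/DoorA34/Lines/strata.lean` on stmt-ValiantsHypothesis-19980 (`DoorA34 = PosRootLawAt 3 4 18`: OPEN, typed, never asserted here), stub
`stub_nullTopCeiling` on the generic sheet, INDEFINITE inertia cell (the cell of every null-top object of record).  Every indefinite singular real
symmetric `3 × 3` letter of rank two is a HYPERBOLIC PAIR `S₃ = h·(vwᵀ + wvᵀ)` (`v`, `w` isotropic, kernel `k ∥ v × w`); this file is the calculus of
that normal form, for ANY `3 × 3` matrix over a commutative ring unless said otherwise (`q_u := uᵀ adj(M) u`, `m_{vw} := vᵀ adj(M) w`, `k := v ×₃ w`,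
`T := kᵀ M k`):

* `det_add_smul_hyperbolic_fin_three` — **HYPERBOLIC GRAFT**: `det(M + h·(vwᵀ + wvᵀ)) = det M + h·(m_{vw} + m_{wv}) − h²·T`: on the null-top sheet
  the MIDDLE window is `2h ×` the BILINEAR adjugate form `vᵀ adj(G) w` and the TOP window is `−h²·kᵀGk` (…NullTopBlocks' `tr(adj G·S₃)`, `tr(adj S₃·G)`);
  the rank-one / flag-law case is `v = w`.
* `adjugate_gram_fin_three` — **ADJUGATE GRAM IDENTITY** (coordinate-free Jacobi): `q_v·q_w − m_{vw}·m_{wv} = det M · T`.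
* `adjugate_quadForm_hyperbolic_left/right` — the graft does not move the two rank-one compressions: `q_v(M + h(vwᵀ+wvᵀ)) = q_v(M)`, same for `w`.
* `hyperbolic_sheet_identity` — for symmetric `M`: `T · det(M + h·(vwᵀ + wvᵀ)) = q_v·q_w − (m_{vw} − h·T)²`; hence at every root of the grafted
  determinant `0 ≤ q_v·q_w` (`quadForm_adjugate_mul_nonneg_at_hyperbolic_root`) and the ROOT-FREE ZONE `q_v·q_w < 0 ⇒ det ≠ 0` for EVERY `h`
  (`det_hyperbolic_ne_zero_of_quadForm_mul_neg`) — chart-free forms of …SheetIsotropicFrame's `T·det F = D₁D₂ − W²`.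
* `quadForm_adjugate_mul_nonneg_of_det_eq_zero`, `quadForm_adjugate_mul_trace_nonneg_of_det_eq_zero` — **TYPE LAW**, coordinate-free: for a
  singular real symmetric `M` all values `uᵀ adj(M) u` have one sign, the sign of `tr adj M` (the census TYPE of a det-root).
* `normSq_sq_mul_quadForm_adjugate_eq`, `quadForm_adjugate_nonpos_of_cross_isotropic` — **ISOTROPY LAW**: `|k|⁴·q_w = T·((w×k)ᵀM(w×k)) −
  (kᵀM(w×k))·((w×k)ᵀMk)`, so for real symmetric `M` with `kᵀMk = 0`, `k = v × w ≠ 0`: `q_v ≤ 0` and `q_w ≤ 0`.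
* `hyperbolic_odd_crossing_law` — **ODD-CROSSING LAW** (the flag-law skeleton of the hyperbolic cell): if `G_r + y·h(vwᵀ+wvᵀ)` is singular of
  type `(−)` (a middle-eigenvalue det-root `r` of the sheet pencil) and `kᵀ G_z k = 0` (a root `z` of the top trinomial), then
  `q_v(G_r) ≤ 0`, `q_w(G_r) ≤ 0`, `q_v(G_z) ≤ 0`, `q_w(G_z) ≤ 0`: neither rank-one compression `q_v`, `q_w` of the CORE changes sign an odd
  number of times between a middle-type root and a top-window root (`0 ≤ q_v(G_r)·q_v(G_z)`).

READING for the line (seat report HOME/DOOR-A34-ENG2G7-REPORT.md): the three windows of a null-top pencil in the indefinite cell are `det G /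
2h·vᵀadj(G)w / −h²·kᵀGk`; a macroscopic middle window needs `4·m² ≫ |q_v q_w − m²| = |T·det G|` between the middle roots (the 2 × 2 matrix
`adj G|_{span(v,w)}` nearly singular); where that holds because `adj G` is nearly rank one the middle roots attach to the zeros of the middle
eigenvector against the planes `v^⊥`, `w^⊥`, and the ODD-CROSSING LAW is the parity constraint the rank-one compressions obey past them.  Nothing here
bounds anything; `DoorA34` and the three stubs stay OPEN; registers unchanged; nothing on `MatrixDescartes` (stmt-ValiantsHypothesis-18050) or
`VP ≠ VNP` — VP≠VNP not moved.  [folklore] rank-one/rank-two updates of `3 × 3` determinants, `adj(adj M) = det M · M`, Cauchy–Binet; `ring`.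
-/

-- `Summit.ValiantsHypothesis.ValiantsHypothesis.…` repeats a component by the D-0017 layout
-- (single-conjunct summit), which the `dupNamespace` linter flags; the name is mandated.
set_option linter.dupNamespace false

namespace Summit.ValiantsHypothesis.ValiantsHypothesis.Theorems.LacunarySymmetroidMatrixDescartes.Census

open scoped BigOperators Matrix
open Matrix

/-! ## 1. Ring identities (any `3 × 3` matrix over a commutative ring) -/

/-- **HYPERBOLIC GRAFT**: `det(M + h·(vwᵀ + wvᵀ)) = det M + h·(vᵀ adj(M) w + wᵀ adj(M) v) − h²·(v × w)ᵀ M (v × w)`. [folklore] -/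
theorem det_add_smul_hyperbolic_fin_three {R : Type*} [CommRing R] (M : Matrix (Fin 3) (Fin 3) R) (h : R) (v w : Fin 3 → R) :
    (M + h • (Matrix.vecMulVec v w + Matrix.vecMulVec w v)).det
      = M.det + h * (v ⬝ᵥ (M.adjugate *ᵥ w) + w ⬝ᵥ (M.adjugate *ᵥ v)) - h ^ 2 * ((v ⨯₃ w) ⬝ᵥ (M *ᵥ (v ⨯₃ w))) := by
  simp only [Matrix.det_fin_three, Matrix.adjugate_fin_three, Matrix.add_apply, Matrix.vecMulVec_apply, Matrix.smul_apply, smul_eq_mul,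
    Matrix.mulVec, dotProduct, Fin.sum_univ_three, Matrix.of_apply, Matrix.cons_val', Matrix.cons_val_zero, Matrix.cons_val_one,
    Matrix.head_cons, Matrix.cons_val_two, Matrix.tail_cons, Matrix.empty_val', Matrix.cons_val_fin_one, Matrix.head_fin_const, cross_apply]
  ring

/-- **ADJUGATE GRAM IDENTITY** (coordinate-free Jacobi / Cauchy–Binet with `adj(adj M) = det M · M`):
`(vᵀ adj(M) v)(wᵀ adj(M) w) − (vᵀ adj(M) w)(wᵀ adj(M) v) = det M · (v × w)ᵀ M (v × w)`. [folklore] -/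
theorem adjugate_gram_fin_three {R : Type*} [CommRing R] (M : Matrix (Fin 3) (Fin 3) R) (v w : Fin 3 → R) :
    (v ⬝ᵥ (M.adjugate *ᵥ v)) * (w ⬝ᵥ (M.adjugate *ᵥ w)) - (v ⬝ᵥ (M.adjugate *ᵥ w)) * (w ⬝ᵥ (M.adjugate *ᵥ v))
      = M.det * ((v ⨯₃ w) ⬝ᵥ (M *ᵥ (v ⨯₃ w))) := by
  simp only [Matrix.det_fin_three, Matrix.adjugate_fin_three, Matrix.mulVec, dotProduct, Fin.sum_univ_three, Matrix.of_apply, Matrix.cons_val',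
    Matrix.cons_val_zero, Matrix.cons_val_one, Matrix.head_cons, Matrix.cons_val_two, Matrix.tail_cons, Matrix.empty_val', Matrix.cons_val_fin_one,
    Matrix.head_fin_const, cross_apply]
  ring

/-- The hyperbolic graft does not move the rank-one compression at `v`: `vᵀ adj(M + h·(vwᵀ + wvᵀ)) v = vᵀ adj(M) v`. [folklore] -/
theorem adjugate_quadForm_hyperbolic_left {R : Type*} [CommRing R] (M : Matrix (Fin 3) (Fin 3) R) (h : R) (v w : Fin 3 → R) :
    v ⬝ᵥ ((M + h • (Matrix.vecMulVec v w + Matrix.vecMulVec w v)).adjugate *ᵥ v) = v ⬝ᵥ (M.adjugate *ᵥ v) := by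
  simp only [Matrix.adjugate_fin_three, Matrix.add_apply, Matrix.vecMulVec_apply, Matrix.smul_apply, smul_eq_mul, Matrix.mulVec, dotProduct,
    Fin.sum_univ_three, Matrix.of_apply, Matrix.cons_val', Matrix.cons_val_zero, Matrix.cons_val_one, Matrix.head_cons, Matrix.cons_val_two,
    Matrix.tail_cons, Matrix.empty_val', Matrix.cons_val_fin_one, Matrix.head_fin_const]
  ring

/-- The hyperbolic graft does not move the rank-one compression at `w`: `wᵀ adj(M + h·(vwᵀ + wvᵀ)) w = wᵀ adj(M) w`. [folklore] -/
theorem adjugate_quadForm_hyperbolic_right {R : Type*} [CommRing R] (M : Matrix (Fin 3) (Fin 3) R) (h : R) (v w : Fin 3 → R) :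
    w ⬝ᵥ ((M + h • (Matrix.vecMulVec v w + Matrix.vecMulVec w v)).adjugate *ᵥ w) = w ⬝ᵥ (M.adjugate *ᵥ w) := by
  simp only [Matrix.adjugate_fin_three, Matrix.add_apply, Matrix.vecMulVec_apply, Matrix.smul_apply, smul_eq_mul, Matrix.mulVec, dotProduct,
    Fin.sum_univ_three, Matrix.of_apply, Matrix.cons_val', Matrix.cons_val_zero, Matrix.cons_val_one, Matrix.head_cons, Matrix.cons_val_two,
    Matrix.tail_cons, Matrix.empty_val', Matrix.cons_val_fin_one, Matrix.head_fin_const]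
  ring

/-- **ISOTROPY IDENTITY**: with `k = v × w`, `|k|⁴·(wᵀ adj(M) w) = (kᵀMk)·((w×k)ᵀM(w×k)) − (kᵀM(w×k))·((w×k)ᵀMk)` — the compression at `w`
written in the basis `(k, w × k)` of `w^⊥`. [folklore] -/
theorem normSq_sq_mul_quadForm_adjugate_eq {R : Type*} [CommRing R] (M : Matrix (Fin 3) (Fin 3) R) (v w : Fin 3 → R) :
    ((v ⨯₃ w) ⬝ᵥ (v ⨯₃ w)) ^ 2 * (w ⬝ᵥ (M.adjugate *ᵥ w))
      = ((v ⨯₃ w) ⬝ᵥ (M *ᵥ (v ⨯₃ w))) * ((w ⨯₃ (v ⨯₃ w)) ⬝ᵥ (M *ᵥ (w ⨯₃ (v ⨯₃ w))))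
        - ((v ⨯₃ w) ⬝ᵥ (M *ᵥ (w ⨯₃ (v ⨯₃ w)))) * ((w ⨯₃ (v ⨯₃ w)) ⬝ᵥ (M *ᵥ (v ⨯₃ w))) := by
  simp only [Matrix.adjugate_fin_three, Matrix.mulVec, dotProduct, Fin.sum_univ_three, Matrix.of_apply, Matrix.cons_val', Matrix.cons_val_zero,
    Matrix.cons_val_one, Matrix.head_cons, Matrix.cons_val_two, Matrix.tail_cons, Matrix.empty_val', Matrix.cons_val_fin_one, Matrix.head_fin_const,
    cross_apply]
  ring

/-! ## 2. The sheet identity and its sign corollaries (real symmetric core) -/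

/-- For a symmetric matrix the bilinear adjugate form is symmetric: `vᵀ adj(M) w = wᵀ adj(M) v`. [folklore] -/
theorem adjugate_bilin_symm {R : Type*} [CommRing R] (M : Matrix (Fin 3) (Fin 3) R) (hM : M.IsSymm) (v w : Fin 3 → R) :
    v ⬝ᵥ (M.adjugate *ᵥ w) = w ⬝ᵥ (M.adjugate *ᵥ v) := by
  have h10 : M 1 0 = M 0 1 := by simpa using congrFun (congrFun hM 0) 1
  have h20 : M 2 0 = M 0 2 := by simpa using congrFun (congrFun hM 0) 2
  have h21 : M 2 1 = M 1 2 := by simpa using congrFun (congrFun hM 1) 2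
  simp only [Matrix.adjugate_fin_three, Matrix.mulVec, dotProduct, Fin.sum_univ_three, Matrix.of_apply, Matrix.cons_val', Matrix.cons_val_zero,
    Matrix.cons_val_one, Matrix.head_cons, Matrix.cons_val_two, Matrix.tail_cons, Matrix.empty_val', Matrix.cons_val_fin_one, Matrix.head_fin_const,
    h10, h20, h21]
  ring

/-- **HYPERBOLIC SHEET IDENTITY** (symmetric core): `T · det(M + h·(vwᵀ + wvᵀ)) = q_v·q_w − (vᵀ adj(M) w − h·T)²`, `T = (v×w)ᵀ M (v×w)`.
On the null-top sheet (`M = G(x)`, `h ↦ h·x^{d₃}`) this is the chart-free form of `T·det F = D₁D₂ − W²` (…SheetIsotropicFrame). [folklore] -/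
theorem hyperbolic_sheet_identity {R : Type*} [CommRing R] (M : Matrix (Fin 3) (Fin 3) R) (hM : M.IsSymm) (h : R) (v w : Fin 3 → R) :
    ((v ⨯₃ w) ⬝ᵥ (M *ᵥ (v ⨯₃ w))) * (M + h • (Matrix.vecMulVec v w + Matrix.vecMulVec w v)).det
      = (v ⬝ᵥ (M.adjugate *ᵥ v)) * (w ⬝ᵥ (M.adjugate *ᵥ w)) - (v ⬝ᵥ (M.adjugate *ᵥ w) - h * ((v ⨯₃ w) ⬝ᵥ (M *ᵥ (v ⨯₃ w)))) ^ 2 := by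
  rw [det_add_smul_hyperbolic_fin_three, ← adjugate_bilin_symm M hM v w]
  have hg := adjugate_gram_fin_three M v w
  rw [← adjugate_bilin_symm M hM v w] at hg
  linear_combination (-1 : R) * hg

/-- At every root of the grafted determinant the two rank-one compressions of the core have the same sign: `0 ≤ q_v·q_w`
(real symmetric core; every `h`). [folklore] -/
theorem quadForm_adjugate_mul_nonneg_at_hyperbolic_root (M : Matrix (Fin 3) (Fin 3) ℝ) (hM : M.IsSymm) (h : ℝ) (v w : Fin 3 → ℝ)
    (hroot : (M + h • (Matrix.vecMulVec v w + Matrix.vecMulVec w v)).det = 0) :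
    0 ≤ (v ⬝ᵥ (M.adjugate *ᵥ v)) * (w ⬝ᵥ (M.adjugate *ᵥ w)) := by
  have hid := hyperbolic_sheet_identity M hM h v w
  rw [hroot, mul_zero] at hid
  nlinarith [sq_nonneg (v ⬝ᵥ (M.adjugate *ᵥ w) - h * ((v ⨯₃ w) ⬝ᵥ (M *ᵥ (v ⨯₃ w))))]

/-- **ROOT-FREE ZONE** (chart-free): where the two rank-one compressions of the core have opposite signs, NO hyperbolic graft on `(v, w)` is
singular — `q_v·q_w < 0 ⇒ det(M + h·(vwᵀ + wvᵀ)) ≠ 0` for every `h`. [folklore] -/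
theorem det_hyperbolic_ne_zero_of_quadForm_mul_neg (M : Matrix (Fin 3) (Fin 3) ℝ) (hM : M.IsSymm) (h : ℝ) (v w : Fin 3 → ℝ)
    (hneg : (v ⬝ᵥ (M.adjugate *ᵥ v)) * (w ⬝ᵥ (M.adjugate *ᵥ w)) < 0) :
    (M + h • (Matrix.vecMulVec v w + Matrix.vecMulVec w v)).det ≠ 0 :=
  fun hroot => absurd (quadForm_adjugate_mul_nonneg_at_hyperbolic_root M hM h v w hroot) (not_le.mpr hneg)

/-! ## 3. TYPE LAW, coordinate-free: on a singular symmetric matrix all adjugate quadratic forms carry the sign of `tr adj` -/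

/-- For a SINGULAR matrix (any commutative ring) the `2 × 2` Gram minors of the adjugate form vanish:
`(vᵀ adj(M) v)(wᵀ adj(M) w) = (vᵀ adj(M) w)(wᵀ adj(M) v)` (`adj M` has rank `≤ 1`). [folklore] -/
theorem quadForm_adjugate_mul_eq_of_det_eq_zero {R : Type*} [CommRing R] (M : Matrix (Fin 3) (Fin 3) R) (hdet : M.det = 0) (v w : Fin 3 → R) :
    (v ⬝ᵥ (M.adjugate *ᵥ v)) * (w ⬝ᵥ (M.adjugate *ᵥ w)) = (v ⬝ᵥ (M.adjugate *ᵥ w)) * (w ⬝ᵥ (M.adjugate *ᵥ v)) := by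
  have hg := adjugate_gram_fin_three M v w
  rw [hdet, zero_mul] at hg
  exact sub_eq_zero.mp hg

/-- **TYPE LAW (pairs)**: for a singular real symmetric `M`, any two adjugate quadratic forms have the same sign: `0 ≤ (vᵀ adj(M) v)(wᵀ adj(M) w)`. [folklore] -/
theorem quadForm_adjugate_mul_nonneg_of_det_eq_zero (M : Matrix (Fin 3) (Fin 3) ℝ) (hM : M.IsSymm) (hdet : M.det = 0) (v w : Fin 3 → ℝ) :
    0 ≤ (v ⬝ᵥ (M.adjugate *ᵥ v)) * (w ⬝ᵥ (M.adjugate *ᵥ w)) := by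
  rw [quadForm_adjugate_mul_eq_of_det_eq_zero M hdet, ← adjugate_bilin_symm M hM v w, ← sq]
  exact sq_nonneg _

/-- The adjugate quadratic form at a coordinate vector is the diagonal adjugate entry. [folklore] -/
theorem quadForm_adjugate_single (M : Matrix (Fin 3) (Fin 3) ℝ) (i : Fin 3) :
    (Pi.single i (1 : ℝ)) ⬝ᵥ (M.adjugate *ᵥ Pi.single i (1 : ℝ)) = M.adjugate i i := by
  rw [Matrix.mulVec_single_one, dotProduct_comm, dotProduct_single_one]
  rfl

/-- **TYPE LAW (trace)**: for a singular real symmetric `M`, every adjugate quadratic form has the sign of `tr adj M` — the census TYPE of a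
det-root (`0 ≤ (vᵀ adj(M) v) · tr adj M`; chart-free form of …SheetIsotropicFrame / …PlaneCompression). [folklore] -/
theorem quadForm_adjugate_mul_trace_nonneg_of_det_eq_zero (M : Matrix (Fin 3) (Fin 3) ℝ) (hM : M.IsSymm) (hdet : M.det = 0) (v : Fin 3 → ℝ) :
    0 ≤ (v ⬝ᵥ (M.adjugate *ᵥ v)) * M.adjugate.trace := by
  rw [Matrix.trace, Fin.sum_univ_three]
  simp only [Matrix.diag_apply]
  have h0 := quadForm_adjugate_mul_nonneg_of_det_eq_zero M hM hdet v (Pi.single 0 1)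
  have h1 := quadForm_adjugate_mul_nonneg_of_det_eq_zero M hM hdet v (Pi.single 1 1)
  have h2 := quadForm_adjugate_mul_nonneg_of_det_eq_zero M hM hdet v (Pi.single 2 1)
  rw [quadForm_adjugate_single] at h0 h1 h2
  nlinarith [h0, h1, h2]

/-- TYPE `(−)` corollary: at a singular symmetric `M` with `tr adj M < 0` every adjugate quadratic form is `≤ 0`. [folklore] -/
theorem quadForm_adjugate_nonpos_of_trace_adjugate_neg (M : Matrix (Fin 3) (Fin 3) ℝ) (hM : M.IsSymm) (hdet : M.det = 0)
    (htr : M.adjugate.trace < 0) (v : Fin 3 → ℝ) : v ⬝ᵥ (M.adjugate *ᵥ v) ≤ 0 := by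
  have h := quadForm_adjugate_mul_trace_nonneg_of_det_eq_zero M hM hdet v
  nlinarith [h, htr]

/-- TYPE `(+)` corollary: at a singular symmetric `M` with `0 < tr adj M` every adjugate quadratic form is `≥ 0`. [folklore] -/
theorem quadForm_adjugate_nonneg_of_trace_adjugate_pos (M : Matrix (Fin 3) (Fin 3) ℝ) (hM : M.IsSymm) (hdet : M.det = 0)
    (htr : 0 < M.adjugate.trace) (v : Fin 3 → ℝ) : 0 ≤ v ⬝ᵥ (M.adjugate *ᵥ v) := by
  have h := quadForm_adjugate_mul_trace_nonneg_of_det_eq_zero M hM hdet v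
  nlinarith [h, htr]

/-! ## 4. ISOTROPY LAW: a root of the top trinomial `kᵀGk` makes both rank-one compressions `≤ 0` -/

/-- **ISOTROPY LAW**: real symmetric `M`, `k = v × w ≠ 0`, `kᵀ M k = 0` ⇒ `wᵀ adj(M) w ≤ 0` (the compression `M|_{w^⊥}` has the isotropic vector
`k`, so its determinant is `≤ 0`). [folklore] -/
theorem quadForm_adjugate_nonpos_of_cross_isotropic (M : Matrix (Fin 3) (Fin 3) ℝ) (hM : M.IsSymm) (v w : Fin 3 → ℝ)
    (hk : v ⨯₃ w ≠ 0) (hiso : (v ⨯₃ w) ⬝ᵥ (M *ᵥ (v ⨯₃ w)) = 0) : w ⬝ᵥ (M.adjugate *ᵥ w) ≤ 0 := by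
  have hid := normSq_sq_mul_quadForm_adjugate_eq M v w
  have h10 : M 1 0 = M 0 1 := by simpa using congrFun (congrFun hM 0) 1
  have h20 : M 2 0 = M 0 2 := by simpa using congrFun (congrFun hM 0) 2
  have h21 : M 2 1 = M 1 2 := by simpa using congrFun (congrFun hM 1) 2
  have hsym : (w ⨯₃ (v ⨯₃ w)) ⬝ᵥ (M *ᵥ (v ⨯₃ w)) = (v ⨯₃ w) ⬝ᵥ (M *ᵥ (w ⨯₃ (v ⨯₃ w))) := by
    simp only [Matrix.mulVec, dotProduct, Fin.sum_univ_three, cross_apply, h10, h20, h21]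
    ring
  rw [hiso, zero_mul, zero_sub, hsym, ← sq] at hid
  have hpos : 0 < ((v ⨯₃ w) ⬝ᵥ (v ⨯₃ w)) ^ 2 := by
    have h0 : 0 < (v ⨯₃ w) ⬝ᵥ (v ⨯₃ w) := by
      simpa only [star_trivial] using Matrix.dotProduct_star_self_pos_iff.mpr hk
    positivity
  by_contra hcon
  have : 0 < ((v ⨯₃ w) ⬝ᵥ (v ⨯₃ w)) ^ 2 * (w ⬝ᵥ (M.adjugate *ᵥ w)) := mul_pos hpos (not_le.mp hcon)
  rw [hid] at this
  nlinarith [sq_nonneg ((v ⨯₃ w) ⬝ᵥ (M *ᵥ (w ⨯₃ (v ⨯₃ w))))]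

/-- ISOTROPY LAW at `v` (swap the pair: `w × v = −(v × w)` is isotropic too). [folklore] -/
theorem quadForm_adjugate_nonpos_of_cross_isotropic_left (M : Matrix (Fin 3) (Fin 3) ℝ) (hM : M.IsSymm) (v w : Fin 3 → ℝ)
    (hk : v ⨯₃ w ≠ 0) (hiso : (v ⨯₃ w) ⬝ᵥ (M *ᵥ (v ⨯₃ w)) = 0) : v ⬝ᵥ (M.adjugate *ᵥ v) ≤ 0 := by
  have hk' : w ⨯₃ v ≠ 0 := by rw [← cross_anticomm]; exact neg_ne_zero.mpr hk
  have hiso' : (w ⨯₃ v) ⬝ᵥ (M *ᵥ (w ⨯₃ v)) = 0 := by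
    rw [← cross_anticomm, Matrix.mulVec_neg, dotProduct_neg, neg_dotProduct, neg_neg, hiso]
  exact quadForm_adjugate_nonpos_of_cross_isotropic M hM w v hk' hiso'

/-! ## 5. The ODD-CROSSING LAW of the hyperbolic cell -/

/-- **ODD-CROSSING LAW.**  Let `G_r`, `G_z` be real symmetric (two values of the core `G(x)`), `S = h·(vwᵀ + wvᵀ)` the hyperbolic top letter,
`k = v × w ≠ 0`.  If `G_r + y·S` is singular of TYPE `(−)` (a middle-eigenvalue det-root of the sheet pencil at `x = r`, `y = r^{d₃}`) and `kᵀ G_z k = 0`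
(a root `z` of the top trinomial), then both rank-one compressions of the core are `≤ 0` at `r` AND at `z`: `q_v`, `q_w` cannot change sign an odd
number of times between a middle-type root and a top-window root.  (The rank-one compressions are untouched by the graft; type law at `r`, isotropy
law at `z`.) [folklore] -/
theorem hyperbolic_odd_crossing_law (Gr Gz : Matrix (Fin 3) (Fin 3) ℝ) (hGr : Gr.IsSymm) (hGz : Gz.IsSymm) (h y : ℝ) (v w : Fin 3 → ℝ)
    (hroot : (Gr + (y * h) • (Matrix.vecMulVec v w + Matrix.vecMulVec w v)).det = 0)
    (htype : (Gr + (y * h) • (Matrix.vecMulVec v w + Matrix.vecMulVec w v)).adjugate.trace < 0)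
    (hk : v ⨯₃ w ≠ 0) (hiso : (v ⨯₃ w) ⬝ᵥ (Gz *ᵥ (v ⨯₃ w)) = 0) :
    v ⬝ᵥ (Gr.adjugate *ᵥ v) ≤ 0 ∧ w ⬝ᵥ (Gr.adjugate *ᵥ w) ≤ 0 ∧ v ⬝ᵥ (Gz.adjugate *ᵥ v) ≤ 0 ∧ w ⬝ᵥ (Gz.adjugate *ᵥ w) ≤ 0 := by
  set F := Gr + (y * h) • (Matrix.vecMulVec v w + Matrix.vecMulVec w v) with hF
  have hFsymm : F.IsSymm := by
    rw [hF]
    refine Matrix.IsSymm.add hGr (Matrix.IsSymm.smul ?_ _)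
    unfold Matrix.IsSymm
    ext i j
    simp only [Matrix.transpose_apply, Matrix.add_apply, Matrix.vecMulVec_apply]
    ring
  refine ⟨?_, ?_, quadForm_adjugate_nonpos_of_cross_isotropic_left Gz hGz v w hk hiso,
    quadForm_adjugate_nonpos_of_cross_isotropic Gz hGz v w hk hiso⟩
  · rw [← adjugate_quadForm_hyperbolic_left Gr (y * h) v w]
    exact quadForm_adjugate_nonpos_of_trace_adjugate_neg F hFsymm hroot htype v
  · rw [← adjugate_quadForm_hyperbolic_right Gr (y * h) v w]
    exact quadForm_adjugate_nonpos_of_trace_adjugate_neg F hFsymm hroot htype w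

/-- **Parity form of the odd-crossing law** for the compression at `v`: `0 ≤ q_v(G_r) · q_v(G_z)`. [folklore] -/
theorem hyperbolic_no_odd_crossing (Gr Gz : Matrix (Fin 3) (Fin 3) ℝ) (hGr : Gr.IsSymm) (hGz : Gz.IsSymm) (h y : ℝ) (v w : Fin 3 → ℝ)
    (hroot : (Gr + (y * h) • (Matrix.vecMulVec v w + Matrix.vecMulVec w v)).det = 0)
    (htype : (Gr + (y * h) • (Matrix.vecMulVec v w + Matrix.vecMulVec w v)).adjugate.trace < 0)
    (hk : v ⨯₃ w ≠ 0) (hiso : (v ⨯₃ w) ⬝ᵥ (Gz *ᵥ (v ⨯₃ w)) = 0) :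
    0 ≤ (v ⬝ᵥ (Gr.adjugate *ᵥ v)) * (v ⬝ᵥ (Gz.adjugate *ᵥ v))
      ∧ 0 ≤ (w ⬝ᵥ (Gr.adjugate *ᵥ w)) * (w ⬝ᵥ (Gz.adjugate *ᵥ w)) := by
  obtain ⟨h1, h2, h3, h4⟩ := hyperbolic_odd_crossing_law Gr Gz hGr hGz h y v w hroot htype hk hiso
  exact ⟨mul_nonneg_of_nonpos_of_nonpos h1 h3, mul_nonneg_of_nonpos_of_nonpos h2 h4⟩

end Summit.ValiantsHypothesis.ValiantsHypothesis.Theorems.LacunarySymmetroidMatrixDescartes.Census
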